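import Literature.AlgebraicGeometry.Resolution.EtaleNeighbourhoodSection
import Mathlib.Data.Fintype.Option
import HarnessLib

/-!
# A common étale neighbourhood with sections through finitely many smooth points

Topic: `Literature/AlgebraicGeometry/Resolution`. Iterating `exists_etale_nhd_section`
(`EtaleNeighbourhoodSection.lean`, EGA IV 17.16.3 over `k = k̄`): for `f : X → Y` locally of
finite presentation over an algebraically closed field `k`, a `k`-point `py` of `Y`, and
FINITELY many closed points `xᵢ ∈ X` in the smooth locus of `f` whose `k`-points lie over `py`,
there is ONE étale `g : U → Y` with a `k`-point `pu` over `py` and, for every `i`, a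
`Y`-morphism `σᵢ : U → X` with `pu ≫ σᵢ =` the `k`-point at `xᵢ` (`exists_common_etale_nhd`):
the fibre product over `Y` of the individual étale neighbourhoods, with the product of their
`k`-points. In de Jong 1996, 4.12 these are the sections, over one étale neighbourhood of
`y ∈ ℙ^{d-1}`, through a smooth point of each component of the fibre `X'_y` (property (ii) b)).
[folklore]; no definitions, no named facts.

## Sources

* A. Grothendieck, J. Dieudonné, EGA IV₄, Cor. 17.16.3 (ii). [Grothendieck1967]
* A. J. de Jong, *Smoothness, semi-stability and alterations*, Publ. Math. IHÉS 83 (1996), 4.12,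
  p. 68. [DeJong1996]
-/

noncomputable section

open CategoryTheory CategoryTheory.Limits AlgebraicGeometry TopologicalSpace

namespace Literature.AlgebraicGeometry.Resolution

universe u

/-- **A common étale neighbourhood with sections through finitely many smooth closed points**:
for finitely many closed points `xᵢ` of `X` in the smooth locus of `f : X → Y`, all over the
`k`-point `py` of `Y`, there are an étale `g : U → Y`, a `k`-point `pu` of `U` over `py` and
`Y`-morphisms `σᵢ : U → X` through the `xᵢ` (induction on the number of points: fibre products
over `Y` of the neighbourhoods of `exists_etale_nhd_section`). [folklore] -/
theorem exists_common_etale_nhd {k : Type u} [Field k] [IsAlgClosed k] {X Y : Scheme.{u}}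
    (gY : Y ⟶ Spec (.of k)) (f : X ⟶ Y) [LocallyOfFinitePresentation f]
    [LocallyOfFiniteType (f ≫ gY)] (py : Spec (.of k) ⟶ Y)
    (ι : Type u) [Finite ι] (x : ι → X) (hxs : ∀ i, x i ∈ f.smoothLocus)
    (hxc : ∀ i, IsClosed ({x i} : Set X))
    (hxy : ∀ i, pointOfClosedPoint (f ≫ gY) (x i) (hxc i) ≫ f = py) :
    ∃ (U : Scheme.{u}) (g : U ⟶ Y) (_ : Etale g) (pu : Spec (.of k) ⟶ U),
      pu ≫ g = py ∧ ∀ i, ∃ σ : U ⟶ X, σ ≫ f = g ∧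
        pu ≫ σ = pointOfClosedPoint (f ≫ gY) (x i) (hxc i) := by
  revert x hxs hxc hxy
  refine Finite.induction_empty_option (P := fun (α : Type u) => ∀ (x : α → X)
      (hxs : ∀ i, x i ∈ f.smoothLocus) (hxc : ∀ i, IsClosed ({x i} : Set X)),
      (∀ i, pointOfClosedPoint (f ≫ gY) (x i) (hxc i) ≫ f = py) →
      ∃ (U : Scheme.{u}) (g : U ⟶ Y) (_ : Etale g) (pu : Spec (.of k) ⟶ U),
        pu ≫ g = py ∧ ∀ i, ∃ σ : U ⟶ X, σ ≫ f = g ∧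
          pu ≫ σ = pointOfClosedPoint (f ≫ gY) (x i) (hxc i)) ?_ ?_ ?_ ι
  · -- invariance under equivalence of index types
    intro α β e h x hxs hxc hxy
    obtain ⟨U, g, hg, pu, hpu, hσ⟩ := h (x ∘ e) (fun a => hxs (e a)) (fun a => hxc (e a))
      (fun a => hxy (e a))
    refine ⟨U, g, hg, pu, hpu, fun b => ?_⟩
    obtain ⟨σ, h1, h2⟩ := hσ (e.symm b)
    refine ⟨σ, h1, ?_⟩
    rw [h2]
    simp only [Function.comp_apply, Equiv.apply_symm_apply]
  · -- no points: `Y` itself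
    intro x _ _ _
    exact ⟨Y, 𝟙 Y, inferInstance, py, Category.comp_id _, fun i => i.elim⟩
  · -- one more point: fibre product with a neighbourhood carrying a section through it
    intro α _ ih x hxs hxc hxy
    obtain ⟨U, g, hg, pu, hpu, hσ⟩ := ih (fun a => x (some a)) (fun a => hxs (some a))
      (fun a => hxc (some a)) (fun a => hxy (some a))
    obtain ⟨U₁, _, g₁, hg₁, σ₁, pu₁, hσ₁, hpu₁⟩ :=
      exists_etale_nhd_section gY f (hxs none) (hxc none)
    have hpu₁g : pu₁ ≫ g₁ = py := by rw [← hσ₁, ← Category.assoc, hpu₁, hxy none]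
    refine ⟨pullback g g₁, pullback.fst g g₁ ≫ g, inferInstance,
      pullback.lift pu pu₁ (by rw [hpu, hpu₁g]), ?_, ?_⟩
    · rw [pullback.lift_fst_assoc, hpu]
    · rintro (_ | a)
      · refine ⟨pullback.snd g g₁ ≫ σ₁, ?_, ?_⟩
        · rw [Category.assoc, hσ₁, pullback.condition]
        · rw [pullback.lift_snd_assoc, hpu₁]
      · obtain ⟨σ, h1, h2⟩ := hσ a
        refine ⟨pullback.fst g g₁ ≫ σ, ?_, ?_⟩
        · rw [Category.assoc, h1]
        · rw [pullback.lift_fst_assoc, h2]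

end Literature.AlgebraicGeometry.Resolution

end
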